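import Summits.QuantumFields.BalabanUV.Beta.EriceFlowEnclosureB12AsPrintedHistoryContagionShiftFlowZero
import Summits.QuantumFields.BalabanUV.Beta.EriceRemainderEnclosureHistoryAutonomyFunctionalShiftLargeLimit

/-!
# Beta / EriceFlowEnclosureB12AsPrintedHistoryContagionShiftFlowZeroAutonomy — ASYMPTOTIC FREEDOM IS CONTAGIOUS, part 38 (junction with d4-p2's AUTONOMY row): NEAR THE
# ZERO HISTORY THE FLOORED ROW (E44)–(E54) APPLIES TO EVERY FADING-MEMORY FUNCTIONAL WITH ONE ASYMPTOTICALLY FREE SOLUTION.  d4-p2's AUTONOMY row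
# (`EriceRemainderEnclosureHistoryAutonomy*`, rows (E44)–(E54)) is written for a functional with a FLOOR `b > 0` on the WHOLE box ]0, γ]^ℕ and a ZEROTH MOMENT `M` (sup-norm
# Lipschitz constant).  Part 32 showed that near the zero history EVERY functional with a memory profile `(C_m, θ)` and ONE asymptotically free solution is floored: `B ≥ (2∕3)β₀`
# on ]0, a]^ℕ whenever `3C_m a ≤ β₀(1 − θ)`, β₀ > 0 its value at the zero history.  Here: (§60) the memory profile IS a zeroth moment `M = C_m∕(1 − θ)` on every box
# (`zerothMoment_of_memoryProfile`), so on the small box BOTH of d4-p2's standing hypotheses are DISCHARGED (`autonomy_regime_smallBox`); (§61) ONE END by name: d4-p2's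
# (E52c) `…FunctionalShiftLargeLimit.exists_tendsto_disc_large_init` (with (E52b) `…FunctionalShiftLarge.exists_threshold_scale` supplying its threshold scale) gives
# **THE RELATIVE Λ-PARAMETER OF ANY TWO TRAJECTORIES VALUED IN THE SMALL BOX, FROM ANY TWO PINS `p, p′ ≤ a`** (`relativeLambda_smallBox`) — complementary to part 34 (there:
# pins carrying part 14's package, solutions free to live in the BIG box, constants (2∕3, 4∕3); here: no package at the pins, solutions confined to ]0, a], d4-p2's constant
# `2e^{6M∕(b√b)}`).  Every other theorem of rows (E44)–(E54) transfers the same way (not spelled out).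
# Abstract in B (β-flow team, prover 1, unit `b2b-balaban-beta-bflow-p1`, gen 39; ROW AP-I·Uc × ROW D4-AUTONOMY — junction)

HONEST FRAMING (page 1 of everything the β sub-cell writes): discharging `BetaPertH` makes Bałaban's UV stability UNCONDITIONAL — a
real constructive-QFT result; it is NOT the continuum limit and NOT the Clay problem.  HONEST DEPENDENCY (cell reorg 2026-08-19,
verbatim): «continuum YM on T⁴ ⇐ BetaPertH ∧ nine spine estimates (0/9 proved); BetaPertH ⇐ (D1) ∧ (D4) ∧ CAP+tail; G-an2-4 gates
asym, D1 and NE2/3/4.»  THIS MODULE DISCHARGES NOTHING: it is BOOKKEEPING BY NAME (part 32's `smallBox_regime`; d4-p2's (E52b) `exists_threshold_scale` and (E52c)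
`exists_tendsto_disc_large_init`, first refusal d4-p2's — consumed BY NAME, nothing of theirs restated or modified) over node U2's HYPOTHESIS SHAPES
`T4BetaStationary.{SeqBox, MemoryProfile}`, `T4BetaFlowWellPosed.MemFlow` on an ABSTRACT functional `B`; whether Bałaban's limit functional is in ANY of these regimes is NOT
PRINTED ([I] p. 298; GAPS G-t4-U2-1∕-2).  [I] = T. Bałaban, Commun. Math. Phys. **109** (1987) 249–301 [Balaban1987RG1].

WHAT THIS FILE PROVES (0 sorry, 0 def): §60 `zerothMoment_of_memoryProfile`, **`autonomy_regime_smallBox`**; §61 **`relativeLambda_smallBox`**.  NOT CLAIMED: the other rows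
of (E44)–(E54) (they transfer verbatim); anything about Bałaban's β; `BetaPertH`; continuum; Clay.
-/

namespace Summit.QuantumFields.BalabanUV.Beta.EriceFlowEnclosureB12AsPrintedHistoryContagionShiftFlowZeroAutonomy

open Finset Filter Topology
open Literature.MathematicalPhysics.QuantumFieldTheory.Balaban1983to89
open Literature.MathematicalPhysics.QuantumFieldTheory.Balaban1983to89.T4BetaStationary (SeqBox MemoryProfile summable_profile)
open Literature.MathematicalPhysics.QuantumFieldTheory.Balaban1983to89.T4BetaFlowWellPosed (MemFlow)
open Summit.QuantumFields.BalabanUV.Beta.EriceFlowEnclosureB12AsPrintedHistoryContagionShiftFlowZero (smallBox_regime)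
open Summit.QuantumFields.BalabanUV.Beta.EriceRemainderEnclosureHistoryAutonomyFunctionalShiftLarge (exists_threshold_scale)
open Summit.QuantumFields.BalabanUV.Beta.EriceRemainderEnclosureHistoryAutonomyFunctionalShiftLargeLimit (exists_tendsto_disc_large_init)

noncomputable section

/-! ## §60 The memory profile is a zeroth moment; d4-p2's standing hypotheses hold on every small box -/

/-- **A MEMORY PROFILE IS A ZEROTH MOMENT**: `MemoryProfile C_m θ γ B` (C_m ≥ 0, 0 ≤ θ < 1) ⟹ for box histories u, u′ with `|u_j − u′_j| ≤ D` at every age,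
`|B u − B u′| ≤ (C_m∕(1 − θ))·D` — d4-p2's hypothesis shape `hB` of rows (E44)–(E54) with `M = C_m∕(1 − θ)`. [folklore] -/
theorem zerothMoment_of_memoryProfile {B : (ℕ → ℝ) → ℝ} {Cm θ γ : ℝ} (hB : MemoryProfile Cm θ γ B) (hCm : 0 ≤ Cm) (hθ0 : 0 ≤ θ) (hθ1 : θ < 1) :
    ∀ u u' : ℕ → ℝ, SeqBox γ u → SeqBox γ u' → ∀ D : ℝ, (∀ j, |u j - u' j| ≤ D) → |B u - B u'| ≤ Cm / (1 - θ) * D := by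
  intro u u' hu hu' D hD
  have hD0 : 0 ≤ D := (abs_nonneg _).trans (hD 0)
  have hs := summable_profile hθ0 hθ1 hu hu'
  have hg : Summable fun j : ℕ => θ ^ j * D := (summable_geometric_of_lt_one hθ0 hθ1).mul_right D
  have hle : ∑' j, θ ^ j * |u j - u' j| ≤ D / (1 - θ) := by
    calc ∑' j, θ ^ j * |u j - u' j| ≤ ∑' j : ℕ, θ ^ j * D :=
          hs.tsum_le_tsum (fun j => mul_le_mul_of_nonneg_left (hD j) (pow_nonneg hθ0 j)) hg
      _ = D / (1 - θ) := by rw [tsum_mul_right, tsum_geometric_of_lt_one hθ0 hθ1]; ring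
  calc |B u - B u'| ≤ Cm * ∑' j, θ ^ j * |u j - u' j| := hB u u' hu hu'
    _ ≤ Cm * (D / (1 - θ)) := mul_le_mul_of_nonneg_left hle hCm
    _ = Cm / (1 - θ) * D := by ring

/-- **d4-p2's AUTONOMY REGIME HOLDS ON EVERY SMALL BOX.**  `B` with memory profile `(C_m, θ)` on ]0, γ]^ℕ, its value β₀ > 0 at the zero history (part 32), a box size
`a ≤ γ` with `3C_m a ≤ β₀(1 − θ)`.  THEN on ]0, a]^ℕ: the ZEROTH MOMENT `M = C_m∕(1 − θ)` and the FLOOR `b = (2∕3)β₀` — the two standing hypotheses of rows (E44)–(E54),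
discharged (with the memory profile on ]0, a] kept as well). [folklore] -/
theorem autonomy_regime_smallBox {B : (ℕ → ℝ) → ℝ} {Cm θ γ β₀ a : ℝ} (hB : MemoryProfile Cm θ γ B) (hCm : 0 ≤ Cm) (hθ0 : 0 ≤ θ) (hθ1 : θ < 1)
    (h0 : ∀ u : ℕ → ℝ, SeqBox γ u → |B u - β₀| ≤ Cm * ∑' j, θ ^ j * u j) (hβ₀ : 0 < β₀) (haγ : a ≤ γ)
    (h3 : 3 * Cm * a ≤ β₀ * (1 - θ)) :
    (∀ u u' : ℕ → ℝ, SeqBox a u → SeqBox a u' → ∀ D : ℝ, (∀ j, |u j - u' j| ≤ D) → |B u - B u'| ≤ Cm / (1 - θ) * D) ∧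
      (∀ u, SeqBox a u → 2 / 3 * β₀ ≤ B u) ∧ MemoryProfile Cm θ a B := by
  obtain ⟨hBa, hlo, -⟩ := smallBox_regime hB hCm hθ0 hθ1 h0 hβ₀ haγ h3
  exact ⟨zerothMoment_of_memoryProfile hBa hCm hθ0 hθ1, hlo, hBa⟩

/-! ## §61 One END by name: the relative Λ-parameter of any two trajectories valued in the small box -/

/-- **THE RELATIVE Λ-PARAMETER OF ANY TWO TRAJECTORIES IN THE SMALL BOX — d4-p2's (E52c) BY NAME.**  Under the data of `autonomy_regime_smallBox` (0 < a), for ANY pins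
`p, p′ ∈ ]0, a]` and ANY box solutions h, h′ of `MemFlow B p ·`, `MemFlow B p′ ·` VALUED IN ]0, a]: the chart offset `1∕h(m)² − 1∕h′(m)²` CONVERGES (to a number bounded as in
(E52c), threshold scale from (E52b)) — NO smallness package at the pins, NO reference needed beyond β₀ > 0; complementary to part 34's `exists_relativeLambda` (pins with part
14's package, solutions free in the big box, constants (2∕3, 4∕3)). [cite: Balaban1987RG1, Thm 2 (0.31) p.259 with (0.20) p.256 and p.298] -/
theorem relativeLambda_smallBox {B : (ℕ → ℝ) → ℝ} {Cm θ γ β₀ a p p' : ℝ} {h h' : ℕ → ℝ} (hB : MemoryProfile Cm θ γ B) (hCm : 0 ≤ Cm) (hθ0 : 0 ≤ θ) (hθ1 : θ < 1)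
    (h0 : ∀ u : ℕ → ℝ, SeqBox γ u → |B u - β₀| ≤ Cm * ∑' j, θ ^ j * u j) (hβ₀ : 0 < β₀) (haγ : a ≤ γ)
    (h3 : 3 * Cm * a ≤ β₀ * (1 - θ)) (hp : 0 < p) (hpa : p ≤ a) (hp' : 0 < p') (hp'a : p' ≤ a)
    (hh : SeqBox a h) (hh' : SeqBox a h') (hf : MemFlow B p h) (hf' : MemFlow B p' h') :
    ∃ δ : ℝ, Tendsto (fun m => 1 / h m ^ 2 - 1 / h' m ^ 2) atTop (𝓝 δ) ∧
      ∃ m₀ : ℕ, |δ| ≤ 2 * Real.exp (6 * (Cm / (1 - θ)) / (2 / 3 * β₀ * Real.sqrt (2 / 3 * β₀)))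
        * (|1 / p ^ 2 - 1 / p' ^ 2| + 2 * (Cm / (1 - θ)) * Real.sqrt (m₀ : ℝ) / Real.sqrt (2 / 3 * β₀)) := by
  have h1θ : 0 < 1 - θ := by linarith
  obtain ⟨hM, hlo, -⟩ := autonomy_regime_smallBox hB hCm hθ0 hθ1 h0 hβ₀ haγ h3
  have hb : 0 < 2 / 3 * β₀ := by positivity
  have hM0 : 0 ≤ Cm / (1 - θ) := by positivity
  obtain ⟨m₀, hq, hK⟩ := exists_threshold_scale hb (Cm / (1 - θ)) a
  obtain ⟨δ, hδ, hδle⟩ := exists_tendsto_disc_large_init hM hM0 hp hpa hp' hp'a hb hlo hh hh' hf hf' hq hK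
  exact ⟨δ, hδ, m₀, hδle⟩

end

end Summit.QuantumFields.BalabanUV.Beta.EriceFlowEnclosureB12AsPrintedHistoryContagionShiftFlowZeroAutonomy
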